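import Literature.MathematicalPhysics.QuantumFieldTheory.OSDistributionSpaceHolomorphic
import Literature.Analysis.OperatorTheory.SesquilinearExtension
import HarnessLib

/-!
# The holomorphic semigroup `e^{-τH}` of an OS family, II: the operators

Osterwalder–Schrader I (CMP 31 (1973)), §4.1, p. 92: "The family `T^τ = T^t V^s`, `τ = t + is`,
is a holomorphic semigroup for `Re τ > 0`, uniformly bounded and strongly continuous for
`Re τ ≥ 0`." Part I (`OSDistributionSpaceHolomorphic`) constructed the diagonal matrix elements
`Q_τ(χ) = ⟪χ, e^{-τH}χ⟫ := ∫ t^τ dν_χ(t)` and proved them holomorphic on `{Re τ > 0}`,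
continuous and bounded by `‖χ‖²` on `{Re τ ≥ 0}`, and equal to `⟪χ, shiftH s χ⟫` for real
`τ = s > 0`. This file builds the **operators**:

* `matrixElemC hE1 x y τ` — the polarization `S_τ(x, y)` of `Q_τ` ("`⟪x, e^{-τH} y⟫`"), equal
  to `⟪x, shiftH s y⟫` for real `s > 0` (`matrixElemC_ofReal`) and to `⟪x, y⟫` at `τ = 0`;
  holomorphic in `τ` on `{Re τ > 0}`, continuous on `{Re τ ≥ 0}`;
* `isSesqForm_matrixElemC` — **sesquilinearity of `S_τ` for every `Re τ ≥ 0`**, transferred from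
  the real axis (where `S_s = ⟪·, e^{-sH}·⟫`) by the identity theorem on the half-plane
  (`Literature.Analysis.OperatorTheory.eqOn_closedHalfPlane_of_eqOn_ofReal`); the bound
  `|S_τ(x, y)| ≤ 2 ‖x‖ ‖y‖` (`norm_matrixElemC_le`, polarization + scaling);
* `holoShiftH hE1 τ` — **the operator `e^{-τH}`**, `Re τ ≥ 0` (Riesz representation of `S_τ`,
  `IsSesqForm.operator`; the junk value `0` for `Re τ < 0`, where no bounded operator exists),
  with `inner_holoShiftH : ⟪x, e^{-τH} y⟫ = S_τ(x, y)`, `holoShiftH_ofReal : e^{-sH} = shiftH s`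
  (`s > 0`), `holoShiftH_zero : e^{-0H} = 1`, and **weak holomorphy**
  (`differentiableOn_inner_holoShiftH`, `continuousOn_inner_holoShiftH`).

The semigroup law, `(e^{-τH})* = e^{-τ̄H}`, the contraction property `‖e^{-τH}‖ ≤ 1`, unitarity
of `e^{isH}` and strong continuity follow in part III.

## References
* K. Osterwalder, R. Schrader, Axioms for Euclidean Green's functions, CMP 31 (1973), §4.1,
  p. 92.
* M. Reed, B. Simon, Methods of Modern Mathematical Physics I (rev. ed. 1980), §VII.2
  (polarization + Riesz lemma, as in the construction of `g(A)`).
-/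

noncomputable section

open MeasureTheory Set Filter
open _root_.Topology
open scoped InnerProductSpace NNReal ComplexConjugate

-- CFC instance chain on `ℋ →L[ℂ] ℋ` (see `OSDistributionSpacePowers`).
set_option synthInstance.maxHeartbeats 200000

namespace Literature.MathematicalPhysics.QuantumFieldTheory

variable {d : ℕ} [NeZero d]

section SchwingerFamily
open Literature.MathematicalPhysics.QuantumLattice (SchwingerFamily)
open Literature.MathematicalPhysics.QuantumLattice.SchwingerFamily
open Literature.MathematicalPhysics.QuantumLattice.SchwingerFamily.OSSpace
open Literature.Analysis.OperatorTheory

variable {𝔖 : SchwingerFamily (EuclideanSpace ℝ (Fin d))} {hE2 : 𝔖.IsOSReflectionPositive}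

/-! ## The polarized matrix elements `S_τ(x, y) = "⟪x, e^{-τH} y⟫"` -/

/-- **The matrix element `⟪x, e^{-τH} y⟫` as a function of `τ`**: the polarization of the diagonal
elements `χ ↦ ⟪χ, e^{-τH} χ⟫ = expectShiftC hE1 χ τ` (Osterwalder–Schrader I (1973), p. 92,
`T^τ`; Reed–Simon I §VII.2, "the polarization identity lets us recover `(ψ, g(A)φ)`"). [cite: OsterwalderSchraderCMP1973, §4.1 p. 92] -/
def _root_.Literature.MathematicalPhysics.QuantumLattice.SchwingerFamily.OSSpace.matrixElemC (hE1 : 𝔖.IsEuclideanCovariant) (x y : OSHilbert 𝔖 hE2) (τ : ℂ) : ℂ :=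
  polarization (fun χ => expectShiftC hE1 χ τ) x y

/-- **On the positive real axis the matrix element is the semigroup matrix element**:
`S_s(x, y) = ⟪x, e^{-sH} y⟫`, `s > 0` (polarization identity for the bounded operator
`shiftH s`). [folklore] -/
theorem _root_.Literature.MathematicalPhysics.QuantumLattice.SchwingerFamily.OSSpace.matrixElemC_ofReal (hE1 : 𝔖.IsEuclideanCovariant) (x y : OSHilbert 𝔖 hE2) {s : ℝ} (hs : 0 < s) :
    matrixElemC hE1 x y s = ⟪x, shiftH hE2 s y⟫_ℂ := by
  simp only [matrixElemC, expectShiftC_ofReal hE1 _ hs]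
  exact (inner_apply_eq_polarization (shiftH hE2 s) x y).symm

/-- At `τ = 0`: `S_0(x, y) = ⟪x, y⟫`. [folklore] -/
theorem _root_.Literature.MathematicalPhysics.QuantumLattice.SchwingerFamily.OSSpace.matrixElemC_zero (hE1 : 𝔖.IsEuclideanCovariant) (x y : OSHilbert 𝔖 hE2) :
    matrixElemC hE1 x y 0 = ⟪x, y⟫_ℂ := by
  have h : (fun χ : OSHilbert 𝔖 hE2 => expectShiftC hE1 χ 0) =
      fun χ => ⟪χ, (1 : OSHilbert 𝔖 hE2 →L[ℂ] OSHilbert 𝔖 hE2) χ⟫_ℂ := by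
    funext χ
    rw [expectShiftC_zero, one_apply_eq_self, inner_self_eq_norm_sq_to_K]
    norm_cast
  rw [matrixElemC, h, ← inner_apply_eq_polarization, one_apply_eq_self]

/-- **Holomorphy of the matrix elements** on `{Re τ > 0}`. [cite: OsterwalderSchraderCMP1973, §4.1 p. 92] -/
theorem _root_.Literature.MathematicalPhysics.QuantumLattice.SchwingerFamily.OSSpace.differentiableOn_matrixElemC (hE1 : 𝔖.IsEuclideanCovariant) (x y : OSHilbert 𝔖 hE2) :
    DifferentiableOn ℂ (matrixElemC hE1 x y) {τ : ℂ | 0 < τ.re} := by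
  have hQ : ∀ χ : OSHilbert 𝔖 hE2, DifferentiableOn ℂ (fun τ => expectShiftC hE1 χ τ) {τ : ℂ | 0 < τ.re} :=
    fun χ => differentiableOn_expectShiftC hE1 χ
  change DifferentiableOn ℂ (fun τ => (expectShiftC hE1 (x + y) τ - expectShiftC hE1 (x - y) τ -
    Complex.I * expectShiftC hE1 (x + Complex.I • y) τ +
    Complex.I * expectShiftC hE1 (x - Complex.I • y) τ) / 4) _
  exact ((((hQ _).sub (hQ _)).sub ((hQ _).const_mul _)).add ((hQ _).const_mul _)).div_const _

/-- **Continuity of the matrix elements** on `{Re τ ≥ 0}`. [cite: OsterwalderSchraderCMP1973, §4.1 p. 92] -/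
theorem _root_.Literature.MathematicalPhysics.QuantumLattice.SchwingerFamily.OSSpace.continuousOn_matrixElemC (hE1 : 𝔖.IsEuclideanCovariant) (x y : OSHilbert 𝔖 hE2) :
    ContinuousOn (matrixElemC hE1 x y) {τ : ℂ | 0 ≤ τ.re} := by
  have hQ : ∀ χ : OSHilbert 𝔖 hE2, ContinuousOn (fun τ => expectShiftC hE1 χ τ) {τ : ℂ | 0 ≤ τ.re} :=
    fun χ => continuousOn_expectShiftC hE1 χ
  change ContinuousOn (fun τ => (expectShiftC hE1 (x + y) τ - expectShiftC hE1 (x - y) τ -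
    Complex.I * expectShiftC hE1 (x + Complex.I • y) τ +
    Complex.I * expectShiftC hE1 (x - Complex.I • y) τ) / 4) _
  exact ((((hQ _).sub (hQ _)).sub (continuousOn_const.mul (hQ _))).add
    (continuousOn_const.mul (hQ _))).div_const _

/-- The quadratic bound for the polarization: `|S_τ(x, y)| ≤ ‖x‖² + ‖y‖²` for `Re τ ≥ 0`. [folklore] -/
theorem _root_.Literature.MathematicalPhysics.QuantumLattice.SchwingerFamily.OSSpace.norm_matrixElemC_le_sq_add_sq (hE1 : 𝔖.IsEuclideanCovariant) (x y : OSHilbert 𝔖 hE2) {τ : ℂ} (hτ : 0 ≤ τ.re) :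
    ‖matrixElemC hE1 x y τ‖ ≤ 1 * (‖x‖ ^ 2 + ‖y‖ ^ 2) :=
  norm_polarization_le (fun χ => by rw [one_mul]; exact norm_expectShiftC_le hE1 χ hτ) x y

/-! ## The transfer principle and sesquilinearity -/

/-- **Transfer from the real axis**: two functions holomorphic on `{Re > 0}`, continuous on
`{Re ≥ 0}` and equal at all real `s > 0` agree at every `τ` with `Re τ ≥ 0`
(`eqOn_closedHalfPlane_of_eqOn_ofReal`, restated pointwise). [folklore] -/
theorem eq_of_eqOn_ofReal {f g : ℂ → ℂ}
    (hf : DifferentiableOn ℂ f {z : ℂ | 0 < z.re}) (hg : DifferentiableOn ℂ g {z : ℂ | 0 < z.re})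
    (hfc : ContinuousOn f {z : ℂ | 0 ≤ z.re}) (hgc : ContinuousOn g {z : ℂ | 0 ≤ z.re})
    (h : ∀ s : ℝ, 0 < s → f s = g s) {τ : ℂ} (hτ : 0 ≤ τ.re) : f τ = g τ :=
  eqOn_closedHalfPlane_of_eqOn_ofReal hf hg hfc hgc h hτ

/-- **Sesquilinearity of `S_τ` for `Re τ ≥ 0`** (each identity holds on the real axis, where
`S_s = ⟪·, e^{-sH} ·⟫`, and both sides are holomorphic in `τ`). [folklore] -/
theorem _root_.Literature.MathematicalPhysics.QuantumLattice.SchwingerFamily.OSSpace.isSesqForm_matrixElemC (hE1 : 𝔖.IsEuclideanCovariant) {τ : ℂ} (hτ : 0 ≤ τ.re) :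
    IsSesqForm fun x y : OSHilbert 𝔖 hE2 => matrixElemC hE1 x y τ := by
  have hD := fun x y : OSHilbert 𝔖 hE2 => differentiableOn_matrixElemC hE1 x y
  have hC := fun x y : OSHilbert 𝔖 hE2 => continuousOn_matrixElemC hE1 x y
  refine ⟨fun x x' y => ?_, fun c x y => ?_, fun x y y' => ?_, fun c x y => ?_⟩
  · refine eq_of_eqOn_ofReal (hD _ _) ((hD _ _).add (hD _ _)) (hC _ _) ((hC _ _).add (hC _ _))
      (fun s hs => ?_) hτ
    simp only [Pi.add_apply, matrixElemC_ofReal hE1 _ _ hs, inner_add_left]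
  · refine eq_of_eqOn_ofReal (hD _ _) ((hD _ _).const_mul _) (hC _ _)
      (continuousOn_const.mul (hC _ _)) (fun s hs => ?_) hτ
    simp only [matrixElemC_ofReal hE1 _ _ hs, inner_smul_left]
  · refine eq_of_eqOn_ofReal (hD _ _) ((hD _ _).add (hD _ _)) (hC _ _) ((hC _ _).add (hC _ _))
      (fun s hs => ?_) hτ
    simp only [Pi.add_apply, matrixElemC_ofReal hE1 _ _ hs, map_add, inner_add_right]
  · refine eq_of_eqOn_ofReal (hD _ _) ((hD _ _).const_mul _) (hC _ _)
      (continuousOn_const.mul (hC _ _)) (fun s hs => ?_) hτ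
    simp only [matrixElemC_ofReal hE1 _ _ hs, map_smul, inner_smul_right]

/-- **The bound `|S_τ(x, y)| ≤ 2 ‖x‖ ‖y‖`** for `Re τ ≥ 0` (quadratic bound + sesquilinear
scaling). [folklore] -/
theorem _root_.Literature.MathematicalPhysics.QuantumLattice.SchwingerFamily.OSSpace.norm_matrixElemC_le (hE1 : 𝔖.IsEuclideanCovariant) {τ : ℂ} (hτ : 0 ≤ τ.re) (x y : OSHilbert 𝔖 hE2) :
    ‖matrixElemC hE1 x y τ‖ ≤ 2 * 1 * ‖x‖ * ‖y‖ :=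
  (isSesqForm_matrixElemC hE1 hτ).norm_le_of_norm_le_sq_add_sq
    (fun x y => norm_matrixElemC_le_sq_add_sq hE1 x y hτ) x y

/-! ## The operators `e^{-τH}` -/

/-- **The holomorphic semigroup operator `e^{-τH}`**, `Re τ ≥ 0`: the bounded operator with
matrix elements `⟪x, e^{-τH} y⟫ = S_τ(x, y)` (Riesz representation of the bounded sesquilinear
function `S_τ`; Osterwalder–Schrader I (1973), p. 92, `T^τ`). For `Re τ < 0` no such bounded
operator exists in general and the junk value `0` is used. [cite: OsterwalderSchraderCMP1973, §4.1 p. 92] -/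
def _root_.Literature.MathematicalPhysics.QuantumLattice.SchwingerFamily.OSSpace.holoShiftH (hE1 : 𝔖.IsEuclideanCovariant) (τ : ℂ) : OSHilbert 𝔖 hE2 →L[ℂ] OSHilbert 𝔖 hE2 :=
  if hτ : 0 ≤ τ.re then
    (isSesqForm_matrixElemC (hE2 := hE2) hE1 hτ).operator (C := 2 * 1) (norm_matrixElemC_le hE1 hτ)
  else 0

/-- **Matrix elements of `e^{-τH}`**: `⟪x, e^{-τH} y⟫ = S_τ(x, y)` for `Re τ ≥ 0`. [folklore] -/
theorem _root_.Literature.MathematicalPhysics.QuantumLattice.SchwingerFamily.OSSpace.inner_holoShiftH (hE1 : 𝔖.IsEuclideanCovariant) {τ : ℂ} (hτ : 0 ≤ τ.re) (x y : OSHilbert 𝔖 hE2) :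
    ⟪x, holoShiftH (hE2 := hE2) hE1 τ y⟫_ℂ = matrixElemC hE1 x y τ := by
  rw [holoShiftH, dif_pos hτ, IsSesqForm.inner_operator]

/-- The junk value: `holoShiftH τ = 0` for `Re τ < 0`. [folklore] -/
theorem _root_.Literature.MathematicalPhysics.QuantumLattice.SchwingerFamily.OSSpace.holoShiftH_of_re_neg (hE1 : 𝔖.IsEuclideanCovariant) {τ : ℂ} (hτ : τ.re < 0) :
    holoShiftH (hE2 := hE2) hE1 τ = 0 := by
  rw [holoShiftH, dif_neg (not_le.2 hτ)]

/-- **`e^{-τH}` extends the OS semigroup**: `holoShiftH s = shiftH s` for real `s > 0`. [cite: OsterwalderSchraderCMP1973, §4.1 p. 92] -/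
theorem _root_.Literature.MathematicalPhysics.QuantumLattice.SchwingerFamily.OSSpace.holoShiftH_ofReal (hE1 : 𝔖.IsEuclideanCovariant) {s : ℝ} (hs : 0 < s) :
    holoShiftH (hE2 := hE2) hE1 s = shiftH hE2 s := by
  refine ContinuousLinearMap.ext fun y => ext_inner_left ℂ fun x => ?_
  rw [inner_holoShiftH hE1 (by simpa using hs.le), matrixElemC_ofReal hE1 x y hs]

/-- **`e^{-0H} = 1`.** [folklore] -/
theorem _root_.Literature.MathematicalPhysics.QuantumLattice.SchwingerFamily.OSSpace.holoShiftH_zero (hE1 : 𝔖.IsEuclideanCovariant) :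
    holoShiftH (hE2 := hE2) hE1 0 = 1 := by
  refine ContinuousLinearMap.ext fun y => ext_inner_left ℂ fun x => ?_
  rw [inner_holoShiftH hE1 (by simp), matrixElemC_zero, one_apply_eq_self]

/-- A first norm bound `‖e^{-τH}‖ ≤ 2` (from the polarization bound; sharpened to `1` in part
III). [folklore] -/
theorem _root_.Literature.MathematicalPhysics.QuantumLattice.SchwingerFamily.OSSpace.opNorm_holoShiftH_le_two (hE1 : 𝔖.IsEuclideanCovariant) (τ : ℂ) :
    ‖holoShiftH (hE2 := hE2) hE1 τ‖ ≤ 2 := by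
  by_cases hτ : 0 ≤ τ.re
  · rw [holoShiftH, dif_pos hτ]
    have h := (isSesqForm_matrixElemC (hE2 := hE2) hE1 hτ).opNorm_operator_le (C := 2 * 1)
      (by norm_num) (norm_matrixElemC_le hE1 hτ)
    simpa using h
  · rw [holoShiftH, dif_neg hτ, norm_zero]; norm_num

/-- **Weak holomorphy of `e^{-τH}`**: `τ ↦ ⟪x, e^{-τH} y⟫` is holomorphic on `{Re τ > 0}`
(Osterwalder–Schrader I (1973), p. 92: "holomorphic semigroup for `Re τ > 0`"). [cite: OsterwalderSchraderCMP1973, §4.1 p. 92] -/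
theorem _root_.Literature.MathematicalPhysics.QuantumLattice.SchwingerFamily.OSSpace.differentiableOn_inner_holoShiftH (hE1 : 𝔖.IsEuclideanCovariant) (x y : OSHilbert 𝔖 hE2) :
    DifferentiableOn ℂ (fun τ => ⟪x, holoShiftH (hE2 := hE2) hE1 τ y⟫_ℂ) {τ : ℂ | 0 < τ.re} :=
  (differentiableOn_matrixElemC hE1 x y).congr fun _ hτ => inner_holoShiftH hE1 (le_of_lt hτ) x y

/-- **Weak continuity of `e^{-τH}` up to the imaginary axis**: `τ ↦ ⟪x, e^{-τH} y⟫` is continuous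
on `{Re τ ≥ 0}` (Osterwalder–Schrader I (1973), p. 92). [cite: OsterwalderSchraderCMP1973, §4.1 p. 92] -/
theorem _root_.Literature.MathematicalPhysics.QuantumLattice.SchwingerFamily.OSSpace.continuousOn_inner_holoShiftH (hE1 : 𝔖.IsEuclideanCovariant) (x y : OSHilbert 𝔖 hE2) :
    ContinuousOn (fun τ => ⟪x, holoShiftH (hE2 := hE2) hE1 τ y⟫_ℂ) {τ : ℂ | 0 ≤ τ.re} :=
  (continuousOn_matrixElemC hE1 x y).congr fun _ hτ => inner_holoShiftH hE1 hτ x y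

end SchwingerFamily

end Literature.MathematicalPhysics.QuantumFieldTheory
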